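import Summits.Ventures.DiscreteObjects.Hadamard.Order167CentralizerFree668
import Summits.Ventures.DiscreteObjects.Hadamard.AutomorphismFixedRows668

/-!
# H(668): the centraliser of an element of order 83 acts faithfully on its eight row orbits (kernel)

Framing: lottery ticket; floor = certified bounds/negative ranges.

Cell pub-namedobj (venture DiscreteObjects), target (H), hadamard gen 21.  Companion of gen 19's `Order167Centralizer668` /
`Order333Centralizer668` for the third large prime.  Let `σ = (π, κ, d, e)` be a signed automorphism of a Hadamard matrix of
order `668` with `π^83 = κ^83 = 1`, `(π, κ) ≠ (1,1)` (gen 5: `4` fixed rows, `4` fixed columns, `8 + 8` orbits of length `83`).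
**`hadamard668_order83_centralizer_rowOrbits`**: if a signed automorphism `τ = (π', κ', d', e')` has parts commuting with `π`,
`κ` and maps every `π`-MOVED row into its own `π`-orbit (`π x ≠ x ⇒ π' x = π^c x`; nothing is assumed on the four fixed rows or
on the columns), then **`(π', κ') = (π^c, κ^c)` for one `c`**.  So `C(σ)/⟨σ⟩` acts FAITHFULLY on the eight row orbits (and
on the eight column orbits): different powers of the shift on different orbits, a non-trivial permutation of the four fixed rows
alone, or an action on the columns alone are impossible.  Proof: `ρ = τσ^m` fixes the orbit of a moved row `x₀` pointwise
(`83` rows); `ρ^83` is trivial on the moved rows and permutes the `4` fixed rows, so `ρ^(83·24)` has trivial row part, hence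
trivial pair (gen 12, `signedAut_snd_eq_one_of_fst_eq_one`): the pair order of `ρ` divides `1992 = 8·3·83`; a factor `3` would
give an element of pair order `249` (excluded, gen 11), a factor `83` an element of order `83` fixing `83 > 4` rows; so the order
divides `8`, `ρ` is trivial on every moved row (`83 ∤ 8c ⇒ …`), i.e. fixes `≥ 664` rows, and a non-trivial `2`-element fixing
`664` rows contradicts the involution census (`f ≤ 332` or `f = 0`).  Reading (paper step over kernel facts): `C(σ)/±⟨σ⟩`
embeds in `S₈`; pair orders in `C(σ)` have the form `2^a · 83^b` (composite-order census: every `q · 83` excluded) and an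
element of order `83` commuting with `σ` lies in `⟨σ⟩` (no `C₈₃ × C₈₃`, gen 16, with `rowIndep_of_not_pow`, gen 21), so the image
is a `2`-subgroup of `S₈` and `|C(σ) : ±⟨σ⟩|` divides `2^7`.  STRUCTURE of a hypothetical object; H(668) untouched; HITS 0/4.
Ours; no `sorry`, no definitions, default heartbeats.
-/

namespace Summit.Ventures.DiscreteObjects.Hadamard

open Finset BigOperators Matrix

open Literature.Combinatorics.Designs.GoethalsSeidel (IsHadamardMatrix)

variable {ι : Type*} [Fintype ι] [DecidableEq ι]

/-- a permutation of a `4`-element subtype has `24`-th power trivial; applied to the restriction of `g` to the fixed set of a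
commuting `π` with exactly four fixed points -/
lemma pow24_apply_of_fixed_four {π g : Equiv.Perm ι} (hc : Commute g π) (h4 : (univ.filter fun x => π x = x).card = 4)
    {x : ι} (hx : π x = x) : (g ^ 24) x = x := by
  have hstab : ∀ y, π (g y) = g y ↔ π y = y := by
    intro y
    rw [← Equiv.Perm.mul_apply, ← hc.eq, Equiv.Perm.mul_apply, g.injective.eq_iff]
  set ρ : Equiv.Perm {y // π y = y} := g.subtypePerm hstab with hρ
  have hcardF : Fintype.card {y // π y = y} = 4 := by rw [Fintype.card_subtype, h4]
  have hρ24 : ρ ^ 24 = 1 := by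
    have h := pow_card_eq_one (G := Equiv.Perm {y // π y = y}) (x := ρ)
    rw [Fintype.card_perm, hcardF, show Nat.factorial 4 = 24 by rfl] at h
    exact h
  have h := congrArg (fun σ : Equiv.Perm {y // π y = y} => (σ ⟨x, hx⟩ : ι)) hρ24
  simp only [hρ, Equiv.Perm.subtypePerm_pow, Equiv.Perm.subtypePerm_apply, Equiv.Perm.coe_one, id_eq] at h
  exact h

section main
variable {H : Matrix ι ι ℤ}

/-- **Order 83: the orbit-preserving centraliser is `⟨σ⟩`** (hypotheses on the moved rows only). -/
theorem hadamard668_order83_centralizer_rowOrbits (hH : IsHadamardMatrix H) (hι : Fintype.card ι = 668)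
    {π κ π' κ' : Equiv.Perm ι} {d e d' e' : ι → ℤ} (haut : IsSignedAut H π κ d e)
    (hπ : π ^ 83 = 1) (hκ : κ ^ 83 = 1) (hne : π ≠ 1 ∨ κ ≠ 1) (haut' : IsSignedAut H π' κ' d' e')
    (hcπ : Commute π' π) (hcκ : Commute κ' κ) (hpres : ∀ x, π x ≠ x → ∃ c : ℕ, π' x = (π ^ c) x) :
    ∃ c : ℕ, π' = π ^ c ∧ κ' = κ ^ c := by
  have p83 : Nat.Prime 83 := by norm_num
  haveI : Fact (Nat.Prime 83) := ⟨p83⟩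
  have hcard : (Fintype.card ι : ℤ) ≠ 0 := by rw [hι]; norm_num
  have hF := hadamard668_fixedRows_83 hH hι π κ d e haut hπ hκ hne
  -- π ≠ 1 (an element with 4 fixed rows), so there is a moved row
  have hπ1 : π ≠ 1 := by
    intro h1
    have h := hF.1
    have hall : (univ.filter fun i : ι => π i = i) = univ :=
      Finset.filter_true_of_mem (fun i _ => by rw [h1, Equiv.Perm.one_apply])
    rw [hall, Finset.card_univ, hι] at h
    omega
  obtain ⟨x₀, hx₀⟩ : ∃ x, π x ≠ x := by
    by_contra h
    push Not at h
    exact hπ1 (Equiv.ext h)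
  have hfree : ∀ x, π x ≠ x → ∀ k, 0 < k → k < 83 → (π ^ k) x ≠ x :=
    fun x hx => free_of_fixed_prime_pow π p83 (by rw [hπ, Equiv.Perm.one_apply]) hx
  obtain ⟨c₀, hc₀⟩ := hpres x₀ hx₀
  obtain ⟨m, q, hm⟩ : ∃ m q : ℕ, c₀ + m = 83 * q := ⟨83 - c₀ % 83, c₀ / 83 + 1, by omega⟩
  -- ρ = τ σ^m, with parts ψ, χ
  have hρ := isSignedAut_mul haut' (isSignedAut_pow haut m)
  set ψ : Equiv.Perm ι := π' * π ^ m with hψdef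
  set χ : Equiv.Perm ι := κ' * κ ^ m with hχdef
  have hcψ : Commute ψ π := hcπ.mul_left (Commute.pow_left (Commute.refl π) m)
  have hcχ : Commute χ κ := hcκ.mul_left (Commute.pow_left (Commute.refl κ) m)
  -- ψ is a power of π at every moved row, with exponent 0 at x₀
  have hψpow : ∀ x, π x ≠ x → ∃ c : ℕ, ψ x = (π ^ c) x := by
    intro x hx
    obtain ⟨c, hc⟩ := hpres x hx
    refine ⟨c + m, ?_⟩
    rw [hψdef, Equiv.Perm.mul_apply, comm_apply_pow_orbit hcπ hc m, ← Equiv.Perm.mul_apply, ← pow_add]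
  have hψx₀ : ψ x₀ = (π ^ 0) x₀ := by
    rw [hψdef, Equiv.Perm.mul_apply, comm_apply_pow_orbit hcπ hc₀ m, ← Equiv.Perm.mul_apply, ← pow_add, hm, pow_mul,
      hπ, one_pow, pow_zero]
  -- powers of ψ fix the orbit of x₀ pointwise
  have hfixorb : ∀ n k : ℕ, (ψ ^ n) ((π ^ k) x₀) = (π ^ k) x₀ := by
    intro n k
    rw [comm_pow_apply_pow_orbit hcψ hψx₀ n k, mul_zero, pow_zero, Equiv.Perm.one_apply]
  -- ψ^83 fixes every moved row
  have h83moved : ∀ x, π x ≠ x → (ψ ^ 83) x = x := by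
    intro x hx
    obtain ⟨c, hc⟩ := hψpow x hx
    have h := comm_pow_apply_pow_orbit hcψ hc 83 0
    rw [pow_zero, Equiv.Perm.one_apply, pow_mul, hπ, one_pow, Equiv.Perm.one_apply] at h
    exact h
  -- so ψ^(83·24) has trivial row part
  have hrow : ψ ^ 1992 = 1 := by
    ext x
    rw [show (1992 : ℕ) = 83 * 24 by norm_num, pow_mul, Equiv.Perm.one_apply]
    by_cases hx : π x = x
    · exact pow24_apply_of_fixed_four ((hcψ).pow_left 83) hF.1 hx
    · exact perm_pow_apply_of_fixed (ψ ^ 83) (h83moved x hx) 24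
  -- hence trivial column part
  have hcol : χ ^ 1992 = 1 := by
    have h := isSignedAut_pow hρ 1992
    rw [hrow] at h
    exact signedAut_snd_eq_one_of_fst_eq_one hH (by rw [hι]) (by rw [hι]; norm_num) h
  -- the pair R = (ψ, χ) has order dividing 1992 = 8 · 3 · 83
  set R : Equiv.Perm ι × Equiv.Perm ι := (ψ, χ) with hRdef
  have hR0 : orderOf R ≠ 0 := (orderOf_pos R).ne'
  have hdvd : orderOf R ∣ 1992 := by
    apply orderOf_dvd_of_pow_eq_one
    rw [hRdef, Prod.pow_mk, hrow, hcol]; rfl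
  have hS : orderOf ((π, κ) : Equiv.Perm ι × Equiv.Perm ι) = 83 := by
    refine orderOf_eq_prime ?_ ?_
    · rw [Prod.pow_mk, hπ, hκ]; rfl
    · intro h
      rw [Prod.mk_eq_one] at h
      rcases hne with h' | h'
      · exact h' h.1
      · exact h' h.2
  have hcommRS : ∀ k : ℕ, Commute (R ^ k) ((π, κ) : Equiv.Perm ι × Equiv.Perm ι) := by
    intro k
    have h1 : Commute R (π, κ) := by
      show (ψ, χ) * (π, κ) = (π, κ) * (ψ, χ)
      rw [Prod.mk_mul_mk, Prod.mk_mul_mk, hcψ.eq, hcχ.eq]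
    exact h1.pow_left k
  have hpowpair : ∀ k : ℕ, R ^ k = ((ψ ^ k, χ ^ k) : Equiv.Perm ι × Equiv.Perm ι) := fun k => by rw [hRdef, Prod.pow_mk]
  -- no factor 3: an element of pair order 3 commuting with σ gives pair order 249
  have h3 : ¬ 3 ∣ orderOf R := by
    intro h3
    set k := orderOf R / 3 with hk
    have hQ : orderOf (R ^ k) = 3 := orderOf_pow_orderOf_div hR0 h3
    have hcop : (orderOf (R ^ k)).Coprime (orderOf ((π, κ) : Equiv.Perm ι × Equiv.Perm ι)) := by
      rw [hQ, hS]; norm_num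
    have hQS := (hcommRS k).orderOf_mul_eq_mul_orderOf_of_coprime hcop
    rw [hQ, hS, hpowpair k, Prod.mk_mul_mk] at hQS
    exact no_hadamard668_signedAut_order_small_large hH hι (ψ ^ k * π) (χ ^ k * κ) _ _
      (isSignedAut_mul (isSignedAut_pow hρ k) haut) (p := 3) (q := 83) (by decide) (by rw [hQS])
  -- no factor 83: an element of order 83 fixes exactly 4 rows, but powers of ψ fix the 83-element orbit of x₀
  have h83 : ¬ 83 ∣ orderOf R := by
    intro h83
    set k := orderOf R / 83 with hk
    have hQ : orderOf (R ^ k) = 83 := orderOf_pow_orderOf_div hR0 h83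
    rw [hpowpair k] at hQ
    obtain ⟨h1, h2, h3'⟩ := pow_data_of_orderOf hQ (a := 1) Nat.one_pos (by norm_num)
    rw [pow_one, pow_one] at h3'
    have h4 := (hadamard668_fixedRows_83 hH hι (ψ ^ k) (χ ^ k) _ _ (isSignedAut_pow hρ k) h1 h2 h3').1
    have hsub : orbFin π 83 x₀ ⊆ univ.filter fun i => (ψ ^ k) i = i := by
      intro z hz
      obtain ⟨j, -, rfl⟩ := Finset.mem_image.mp hz
      exact Finset.mem_filter.mpr ⟨Finset.mem_univ _, hfixorb k j⟩
    have hle := Finset.card_le_card hsub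
    rw [card_orbFin_of_free (hfree x₀ hx₀), h4] at hle
    omega
  -- so the order divides 8
  have h8 : orderOf R ∣ 8 := by
    have hcop : (orderOf R).Coprime 249 := by
      rw [show (249 : ℕ) = 3 * 83 by norm_num]
      exact Nat.Coprime.mul_right ((Nat.Prime.coprime_iff_not_dvd (by norm_num)).mpr h3).symm
        ((Nat.Prime.coprime_iff_not_dvd p83).mpr h83).symm
    exact hcop.dvd_of_dvd_mul_right (by rw [show (8 : ℕ) * 249 = 1992 by norm_num]; exact hdvd)
  have hR8 : R ^ 8 = 1 := orderOf_dvd_iff_pow_eq_one.mp h8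
  have hψ8 : ψ ^ 8 = 1 := by
    rw [hpowpair 8, Prod.mk_eq_one] at hR8
    exact hR8.1
  -- ψ fixes every moved row
  have hψmoved : ∀ x, π x ≠ x → ψ x = x := by
    intro x hx
    obtain ⟨c, hc⟩ := hψpow x hx
    have h := comm_pow_apply_pow_orbit hcψ hc 8 0
    rw [pow_zero, Equiv.Perm.one_apply, hψ8, Equiv.Perm.one_apply, ← pow_mod_of_pow_eq_one π hπ (8 * c)] at h
    -- (π^((8c) % 83)) x = x forces (8c) % 83 = 0
    have hmod : (8 * c) % 83 = 0 := by
      by_contra hne0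
      exact hfree x hx ((8 * c) % 83) (Nat.pos_of_ne_zero hne0) (Nat.mod_lt _ (by norm_num)) h.symm
    have hc0 : c % 83 = 0 := by omega
    rw [hc, ← pow_mod_of_pow_eq_one π hπ c, hc0, pow_zero, Equiv.Perm.one_apply]
  -- hence R = 1: otherwise a power of R is an involution pair whose row part fixes ≥ 664 rows
  have hR1 : R = 1 := by
    by_contra hR1
    have h2dvd : 2 ∣ orderOf R := by
      have hmem : orderOf R ∈ Nat.divisors 8 := Nat.mem_divisors.mpr ⟨h8, by norm_num⟩
      have hdiv : Nat.divisors 8 = {1, 2, 4, 8} := by decide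
      rw [hdiv] at hmem
      simp only [Finset.mem_insert, Finset.mem_singleton] at hmem
      rcases hmem with h | h | h | h
      · exact absurd (orderOf_eq_one_iff.mp h) hR1
      · rw [h]
      · rw [h]; norm_num
      · rw [h]; norm_num
    set k := orderOf R / 2 with hk
    have hQ : orderOf (R ^ k) = 2 := orderOf_pow_orderOf_div hR0 h2dvd
    rw [hpowpair k] at hQ
    obtain ⟨h1, h2, h3'⟩ := pow_data_of_orderOf hQ (a := 1) Nat.one_pos (by norm_num)
    rw [pow_one, pow_one] at h3'
    -- the row part of R^k fixes all π-moved rows: at least 664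
    have hsub : (univ.filter fun x => π x ≠ x) ⊆ univ.filter fun x => (ψ ^ k) x = x := by
      intro x hx
      exact Finset.mem_filter.mpr ⟨Finset.mem_univ _, perm_pow_apply_of_fixed ψ (hψmoved x (Finset.mem_filter.mp hx).2) k⟩
    have hmovedcard : (univ.filter fun x => π x ≠ x).card = 664 := by
      have h := Finset.card_filter_add_card_filter_not (s := (univ : Finset ι)) (fun x => π x = x)
      rw [hF.1, Finset.card_univ, hι] at h
      have : (univ.filter fun x => ¬ π x = x) = univ.filter fun x => π x ≠ x := rfl
      rw [this] at h
      omega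
    have hge := Finset.card_le_card hsub
    rw [hmovedcard] at hge
    obtain ⟨-, -, hcases⟩ := hadamard668_involution_census_final hH hι (ψ ^ k) (χ ^ k) _ _ (isSignedAut_pow hρ k) h1 h2 h3'
    rcases hcases with ⟨-, -, -, h332, -⟩ | ⟨h0, -, -, -⟩
    · omega
    · omega
  rw [hRdef, Prod.mk_eq_one] at hR1
  refine ⟨82 * m, ?_, ?_⟩
  · have hb : π ^ m * π ^ (82 * m) = 1 := by
      rw [← pow_add, show m + 82 * m = 83 * m by ring, pow_mul, hπ, one_pow]
    calc π' = π' * (π ^ m * π ^ (82 * m)) := by rw [hb, mul_one]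
      _ = (π' * π ^ m) * π ^ (82 * m) := by rw [mul_assoc]
      _ = π ^ (82 * m) := by rw [← hψdef, hR1.1, one_mul]
  · have hb : κ ^ m * κ ^ (82 * m) = 1 := by
      rw [← pow_add, show m + 82 * m = 83 * m by ring, pow_mul, hκ, one_pow]
    calc κ' = κ' * (κ ^ m * κ ^ (82 * m)) := by rw [hb, mul_one]
      _ = (κ' * κ ^ m) * κ ^ (82 * m) := by rw [mul_assoc]
      _ = κ ^ (82 * m) := by rw [← hχdef, hR1.2, one_mul]

end main

end Summit.Ventures.DiscreteObjects.Hadamard
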